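/-
Origin: expansion seat `planner-pub-hodgecm-toy-g2-0`, handover #13 2026-08-18T07:40:52Z (`HOME/pub-hodgecm-toy-g2/lean/ToyG2/PeriodLeaf.lean`, md5 2f187e9a, 320 lines);
landed by the gen-7 packager in gate run 26 as `HodgeCM/Model/ToyG2/PeriodLeaf.lean` (import ^import ToyG2\.→import HodgeCM.Model.ToyG2. ×4).
-/
/-
Copyright (c) 2026. All rights reserved.
Released under Apache 2.0 license as described in the file LICENSE.
-/
import Mathlib
import Summits.HodgeConjecture.HodgeCM.Model.ToyG2.Blocks_2
import Summits.HodgeConjecture.HodgeCM.Model.ToyG2.RiemannSystem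
import Summits.HodgeConjecture.HodgeCM.Model.ToyG2.Trace
import Summits.HodgeConjecture.HodgeCM.Model.ToyG2.Axioms2
import Summits.HodgeConjecture.HodgeCM.Model.Inhabited

/-!
# ToyG2.PeriodLeaf — the period block `P(L, ι₁)` and the concrete generation-2 universe

DESIGN.md §2–§3, §7.  For a CM field `L` and an embedding `ι₁ : L →+* ℂ` let
`Q(L, ι₁) = {Θ : Fin 4 → CMType L | PairSum Θ ∧ ∀ i, ι₁ ∈ Θᵢ}` (a finite set, nonempty: the constant
quadruple on a type containing `ι₁`).  The **period block** of the generation-2 universe at `(L, ι₁)` is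

  `P(L, ι₁) = ∏_{q ∈ Q(L, ι₁)} M_{Θ_q}`,  `ℓ = ∑_q ℓ_{Θ_q} ∘ ⋀⁴(pr_q)`,

where `M_Θ = PP L Θ` is the block of `ToyG2.Blocks` with its period functional `ℓ_Θ = ellLin L Θ ξ d t`
built on a Riemann system `ξ = ξ(q)` (`ToyG2.RiemannSystem.exists_riemannSystem`).  This file builds the
iterated product with its projections / inclusions (§1), the summed functional and its restriction to a
factor (§2: `sumForm_comp_incl`), the index type `QIdx L ι₁` with its enumeration and Riemann systems
(§3), the leaf `pLeafOf L ι₁ d t : PLeaf` with **`pLeafOf_ℓ_ne_zero`** (§4), and finally the block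
assignment `plOf d t : PBlocks` and **the concrete universe**
`toyUniverse₂ d t := toyModel2With exteriorHodgeData traceSys (plOf d t)` (§5), for which 27 of the 28
`ModelAxioms` are already kernel theorems (`toyUniverse₂_modelAxioms_of_gysin`, from
`ToyG2.Axioms2.toyModel2_axioms_of'`) and the period-surface trace is the nonzero functional `ℓ`
(`toyUniverse₂_tr_pms`, `toyUniverse₂_tr_pms_ne_zero`) — the hypothesis of the Gysin leg (DESIGN.md §7).
The parameters `d t : ℚ` are kept free (the positivity analysis `ToyG2.BlockGram` uses `d = 2`, `t = ±1`).
-/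

namespace HodgeCM.ToyG2

open HodgeCM.Toy HodgeCM.Toy.CMPresentation
open Literature.AlgebraicGeometry.Motives (CMType)
open Literature.AlgebraicGeometry.ShimuraVarieties (conjRingHomK)
open scoped TensorProduct

noncomputable section

/-! ### §1 Iterated products of generation-1 objects -/

/-- the generation-1 object with no atoms -/
@[reducible] def emptyObj : Obj := ⟨.empty, fun e => e.elim, 0⟩

/-- the iterated product `B₀ × (B₁ × (⋯ × (B_{m-1} × ∅)))` of a family of generation-1 objects -/
def prodFam : (m : ℕ) → (Fin m → Obj) → Obj
  | 0, _ => emptyObj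
  | m + 1, B => (B 0).prod (prodFam m fun k => B k.succ)

/-- restriction of `H¹(∏ₖ Bₖ) = ⊕ₖ L(Bₖ)` to the `k`-th factor -/
def projFam : (m : ℕ) → (B : Fin m → Obj) → (k : Fin m) → ((prodFam m B).L →ₗ[ℚ] (B k).L)
  | 0, _, k => k.elim0
  | m + 1, B, k =>
      Fin.cases (motive := fun k => ((prodFam (m + 1) B).L →ₗ[ℚ] (B k).L))
        (fstL (B 0) (prodFam m fun k => B k.succ))
        (fun k' => projFam m (fun k => B k.succ) k' ∘ₗ sndL (B 0) (prodFam m fun k => B k.succ)) k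

/-- extension by zero `L(Bₖ) → H¹(∏ₖ Bₖ)` (pull-back along the `k`-th projection) -/
def inclFam : (m : ℕ) → (B : Fin m → Obj) → (k : Fin m) → ((B k).L →ₗ[ℚ] (prodFam m B).L)
  | 0, _, k => k.elim0
  | m + 1, B, k =>
      Fin.cases (motive := fun k => ((B k).L →ₗ[ℚ] (prodFam (m + 1) B).L))
        ((B 0).inlL (prodFam m fun k => B k.succ))
        (fun k' => (B 0).inrL (prodFam m fun k => B k.succ) ∘ₗ inclFam m (fun k => B k.succ) k') k

section fam

variable (m : ℕ) (B : Fin (m + 1) → Obj)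

/-- (Ported verbatim from the HodgeCMPerL package; no docstring in the source.) -/
@[simp] lemma projFam_zero :
    projFam (m + 1) B 0 = fstL (B 0) (prodFam m fun k => B k.succ) := rfl

/-- (Ported verbatim from the HodgeCMPerL package; no docstring in the source.) -/
@[simp] lemma projFam_succ (k' : Fin m) :
    projFam (m + 1) B k'.succ
      = projFam m (fun k => B k.succ) k' ∘ₗ sndL (B 0) (prodFam m fun k => B k.succ) := rfl

/-- (Ported verbatim from the HodgeCMPerL package; no docstring in the source.) -/
@[simp] lemma inclFam_zero :
    inclFam (m + 1) B 0 = (B 0).inlL (prodFam m fun k => B k.succ) := rfl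

/-- (Ported verbatim from the HodgeCMPerL package; no docstring in the source.) -/
@[simp] lemma inclFam_succ (k' : Fin m) :
    inclFam (m + 1) B k'.succ
      = (B 0).inrL (prodFam m fun k => B k.succ) ∘ₗ inclFam m (fun k => B k.succ) k' := rfl

end fam

/-- `pr_k ∘ incl_k = id` -/
theorem projFam_inclFam_self : ∀ (m : ℕ) (B : Fin m → Obj) (k : Fin m) (x : (B k).L),
    projFam m B k (inclFam m B k x) = x
  | 0, _, k => k.elim0
  | m + 1, B, k => by
    refine Fin.cases (motive := fun k => ∀ x : (B k).L,
      projFam (m + 1) B k (inclFam (m + 1) B k x) = x) ?_ ?_ k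
    · intro x
      exact fstL_inlL (B 0) (prodFam m fun k => B k.succ) x
    · intro k' x
      show projFam m (fun k => B k.succ) k' (sndL (B 0) (prodFam m fun k => B k.succ)
        ((B 0).inrL (prodFam m fun k => B k.succ) (inclFam m (fun k => B k.succ) k' x))) = x
      rw [sndL_inrL]
      exact projFam_inclFam_self m (fun k => B k.succ) k' x

/-- `pr_{k'} ∘ incl_k = 0` for `k' ≠ k` -/
theorem projFam_inclFam_of_ne : ∀ (m : ℕ) (B : Fin m → Obj) (k k' : Fin m), k' ≠ k →
    ∀ x : (B k).L, projFam m B k' (inclFam m B k x) = 0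
  | 0, _, k => k.elim0
  | m + 1, B, k => by
    refine Fin.cases (motive := fun k => ∀ k' : Fin (m + 1), k' ≠ k →
      ∀ x : (B k).L, projFam (m + 1) B k' (inclFam (m + 1) B k x) = 0) ?_ ?_ k
    · intro k'
      refine Fin.cases (motive := fun k' => k' ≠ 0 →
        ∀ x : (B 0).L, projFam (m + 1) B k' (inclFam (m + 1) B 0 x) = 0) ?_ ?_ k'
      · intro h
        exact absurd rfl h
      · intro j _ x
        show projFam m (fun k => B k.succ) j (sndL (B 0) (prodFam m fun k => B k.succ)
          ((B 0).inlL (prodFam m fun k => B k.succ) x)) = 0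
        rw [sndL_inlL, map_zero]
    · intro i k'
      refine Fin.cases (motive := fun k' => k' ≠ i.succ →
        ∀ x : (B i.succ).L, projFam (m + 1) B k' (inclFam (m + 1) B i.succ x) = 0) ?_ ?_ k'
      · intro _ x
        exact fstL_inrL (B 0) (prodFam m fun k => B k.succ) _
      · intro j h x
        have h' : j ≠ i := fun e => h (by rw [e])
        show projFam m (fun k => B k.succ) j (sndL (B 0) (prodFam m fun k => B k.succ)
          ((B 0).inrL (prodFam m fun k => B k.succ) (inclFam m (fun k => B k.succ) i x))) = 0
        rw [sndL_inrL]
        exact projFam_inclFam_of_ne m (fun k => B k.succ) i j h' x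

/-! ### §2 The sum of pulled-back degree-4 functionals -/

section sumForm

variable (m : ℕ) (B : Fin m → Obj) (φ : ∀ k : Fin m, (⋀[ℚ]^4 (B k).L) →ₗ[ℚ] ℚ)

/-- `∑ₖ φₖ ∘ ⋀⁴(pr_k)` on `⋀⁴ H¹(∏ₖ Bₖ)` -/
def sumForm : (⋀[ℚ]^4 (prodFam m B).L) →ₗ[ℚ] ℚ :=
  ∑ k, φ k ∘ₗ exteriorPower.map 4 (projFam m B k)

/-- restricted to (the pull-back of) the `k`-th factor, the summed functional is `φₖ` -/
theorem sumForm_comp_incl (k : Fin m) :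
    sumForm m B φ ∘ₗ exteriorPower.map 4 (inclFam m B k) = φ k := by
  apply exteriorPower.linearMap_ext
  ext v
  simp only [LinearMap.compAlternatingMap_apply, LinearMap.comp_apply, exteriorPower.map_apply_ιMulti,
    sumForm, LinearMap.coe_sum, Finset.sum_apply]
  rw [Finset.sum_eq_single k]
  · congr 1
    congr 1
    funext i
    simp [projFam_inclFam_self]
  · intro k' _ hk'
    have h0 : (⇑(projFam m B k') ∘ (⇑(inclFam m B k) ∘ v)) = 0 :=
      funext fun i => by simp [projFam_inclFam_of_ne m B k k' hk']
    rw [h0, AlternatingMap.map_zero, LinearMap.map_zero]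
  · intro h
    exact absurd (Finset.mem_univ k) h

variable {m B φ}

/-- hence it is nonzero as soon as one summand is -/
theorem sumForm_ne_zero {k : Fin m} (h : φ k ≠ 0) : sumForm m B φ ≠ 0 := fun h0 =>
  h (by rw [← sumForm_comp_incl m B φ k, h0, LinearMap.zero_comp])

end sumForm

/-! ### §3 The index set `Q(L, ι₁)`, its enumeration, and a Riemann system per index -/

section Q

variable (L : CMField) (ι₁ : L →+* ℂ)

/-- the admissible quadruples of CM types at `ι₁`: pair-sum, all containing `ι₁` -/
def QIdx : Type := {Θ : Fin 4 → CMType L // PairSum Θ ∧ ∀ i, ι₁ ∈ (Θ i).1}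

/-- (Ported verbatim from the HodgeCMPerL package; no docstring in the source.) -/
instance instFiniteCMType : Finite (CMType L) := by
  unfold CMType
  infer_instance

/-- (Ported verbatim from the HodgeCMPerL package; no docstring in the source.) -/
instance instFiniteQIdx : Finite (QIdx L ι₁) := by
  unfold QIdx
  infer_instance

/-- `#Q(L, ι₁)` -/
def nQ : ℕ := Nat.card (QIdx L ι₁)

/-- an enumeration of `Q(L, ι₁)` -/
def eQ : QIdx L ι₁ ≃ Fin (nQ L ι₁) := Finite.equivFin _

/-- the `k`-th quadruple of types -/
def ΘOf (k : Fin (nQ L ι₁)) : Fin 4 → CMType L := ((eQ L ι₁).symm k).1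

/-- (Ported verbatim from the HodgeCMPerL package; no docstring in the source.) -/
lemma pairSum_ΘOf (k : Fin (nQ L ι₁)) : PairSum (ΘOf L ι₁ k) := ((eQ L ι₁).symm k).2.1

/-- (Ported verbatim from the HodgeCMPerL package; no docstring in the source.) -/
lemma mem_ΘOf (k : Fin (nQ L ι₁)) (i : Fin 4) : ι₁ ∈ (ΘOf L ι₁ k i).1 := ((eQ L ι₁).symm k).2.2 i

/-- a Riemann system for the `k`-th quadruple (`exists_riemannSystem`) -/
def ξOf (k : Fin (nQ L ι₁)) : Fin 4 → L :=
  Classical.choose (exists_riemannSystem (ΘOf L ι₁ k) (pairSum_ΘOf L ι₁ k))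

/-- (Ported verbatim from the HodgeCMPerL package; no docstring in the source.) -/
lemma ξOf_spec (k : Fin (nQ L ι₁)) :
    (∀ i, conjRingHomK L (ξOf L ι₁ k i) = -ξOf L ι₁ k i) ∧
    (∀ i (θ : L →+* ℂ), (θ (ξOf L ι₁ k i)).re = 0) ∧
    (∀ i (θ : L →+* ℂ), (0 < (θ (ξOf L ι₁ k i)).im ↔ θ ∈ (ΘOf L ι₁ k i).1)) ∧
    ξOf L ι₁ k 0 * ξOf L ι₁ k 1 = ξOf L ι₁ k 2 * ξOf L ι₁ k 3 :=
  Classical.choose_spec (exists_riemannSystem (ΘOf L ι₁ k) (pairSum_ΘOf L ι₁ k))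

/-- (Ported verbatim from the HodgeCMPerL package; no docstring in the source.) -/
lemma ξOf_conj (k : Fin (nQ L ι₁)) (i : Fin 4) : conjRingHomK L (ξOf L ι₁ k i) = -ξOf L ι₁ k i :=
  (ξOf_spec L ι₁ k).1 i

/-- (Ported verbatim from the HodgeCMPerL package; no docstring in the source.) -/
lemma ξOf_re (k : Fin (nQ L ι₁)) (i : Fin 4) (θ : L →+* ℂ) : (θ (ξOf L ι₁ k i)).re = 0 :=
  (ξOf_spec L ι₁ k).2.1 i θ

/-- (Ported verbatim from the HodgeCMPerL package; no docstring in the source.) -/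
lemma ξOf_im_pos_iff (k : Fin (nQ L ι₁)) (i : Fin 4) (θ : L →+* ℂ) :
    0 < (θ (ξOf L ι₁ k i)).im ↔ θ ∈ (ΘOf L ι₁ k i).1 :=
  (ξOf_spec L ι₁ k).2.2.1 i θ

/-- (Ported verbatim from the HodgeCMPerL package; no docstring in the source.) -/
lemma ξOf_prod (k : Fin (nQ L ι₁)) :
    ξOf L ι₁ k 0 * ξOf L ι₁ k 1 = ξOf L ι₁ k 2 * ξOf L ι₁ k 3 :=
  (ξOf_spec L ι₁ k).2.2.2

/-- the Riemann elements are nonzero (their `ι₁`-image has positive imaginary part) -/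
lemma ξOf_ne_zero (k : Fin (nQ L ι₁)) (i : Fin 4) : ξOf L ι₁ k i ≠ 0 := fun h => by
  have h1 := (ξOf_im_pos_iff L ι₁ k i ι₁).mpr (mem_ΘOf L ι₁ k i)
  rw [h, map_zero] at h1
  simp at h1

/-- a CM type containing `ι₁` -/
def typeAt : CMType L :=
  by classical exact if ι₁ ∈ (stdCMType L).1 then stdCMType L else CMTypeOps.bar (stdCMType L)

/-- (Ported verbatim from the HodgeCMPerL package; no docstring in the source.) -/
lemma mem_typeAt : ι₁ ∈ (typeAt L ι₁).1 := by
  unfold typeAt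
  split_ifs with h
  · exact h
  · simpa using h

/-- `Q(L, ι₁)` is nonempty: the constant quadruple on `typeAt` -/
def qAt : QIdx L ι₁ := ⟨fun _ => typeAt L ι₁, fun _ => rfl, fun _ => mem_typeAt L ι₁⟩

end Q

/-! ### §4 The period leaf `P(L, ι₁)` -/

section leaf

variable (L : CMField) (ι₁ : L →+* ℂ) (d t : ℚ)

/-- the blocks `M_{Θ_q}`, `q ∈ Q(L, ι₁)` -/
def blockFam (k : Fin (nQ L ι₁)) : Obj := PP L (ΘOf L ι₁ k)

/-- **the period leaf** `P(L, ι₁) = (∏_q M_{Θ_q}, ∑_q ℓ_{Θ_q} ∘ ⋀⁴ pr_q)` -/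
def pLeafOf : PLeaf :=
  ⟨prodFam (nQ L ι₁) (blockFam L ι₁),
   sumForm (nQ L ι₁) (blockFam L ι₁) fun k => ellLin L (ΘOf L ι₁ k) (ξOf L ι₁ k) d t⟩

/-- (Ported verbatim from the HodgeCMPerL package; no docstring in the source.) -/
@[simp] lemma pLeafOf_O : (pLeafOf L ι₁ d t).O = prodFam (nQ L ι₁) (blockFam L ι₁) := rfl

/-- (Ported verbatim from the HodgeCMPerL package; no docstring in the source.) -/
@[simp] lemma pLeafOf_ℓ : (pLeafOf L ι₁ d t).ℓ
    = sumForm (nQ L ι₁) (blockFam L ι₁) fun k => ellLin L (ΘOf L ι₁ k) (ξOf L ι₁ k) d t := rfl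

/-- restricted to the block `q`, the period functional is `ℓ_{Θ_q}` -/
theorem pLeafOf_ℓ_comp_incl (k : Fin (nQ L ι₁)) :
    (pLeafOf L ι₁ d t).ℓ ∘ₗ exteriorPower.map 4 (inclFam (nQ L ι₁) (blockFam L ι₁) k)
      = ellLin L (ΘOf L ι₁ k) (ξOf L ι₁ k) d t :=
  sumForm_comp_incl _ _ _ k

/-- **the period functional of `P(L, ι₁)` is nonzero** (for all parameters `d, t`) -/
theorem pLeafOf_ℓ_ne_zero : (pLeafOf L ι₁ d t).ℓ ≠ 0 :=
  sumForm_ne_zero (k := eQ L ι₁ (qAt L ι₁))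
    (ellLin_ne_zero L _ d t (ξOf_conj L ι₁ _) (ξOf_ne_zero L ι₁ _))

end leaf

/-! ### §5 The concrete generation-2 universe -/

section universe₂

variable (d t : ℚ)

/-- the block assignment `(L, ι₁) ↦ P(L, ι₁)` -/
def plOf : PBlocks := fun L ι₁ => pLeafOf L ι₁ d t

/-- **the concrete generation-2 toy universe** (exterior-algebra cohomology and Hodge data of
generation 1, the Künneth trace system `traceSys`, and the period blocks `P(L, ι₁)`) -/
abbrev toyUniverse₂ : Universe := toyModel2With exteriorHodgeData traceSys (plOf d t)

/-- 27 of the 28 `ModelAxioms` hold in `toyUniverse₂`; only the Gysin identity for surfaces is left as a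
displayed hypothesis (`ToyG2.Axioms2.toyModel2_axioms_of'`) -/
theorem toyUniverse₂_modelAxioms_of_gysin (h : (toyUniverse₂ d t).Fact_gysin_surface) :
    (toyUniverse₂ d t).ModelAxioms :=
  toyModel2_axioms_of' traceSys (plOf d t) h

/-- the period surface of `toyUniverse₂` at `(L, ι₁)` is the block object on `P(L, ι₁)` -/
theorem toyUniverse₂_pms (L : CMField) (ι₁ : L →+* ℂ) (V : HermSpace3 L ι₁) (Γ : Level V) :
    (toyUniverse₂ d t).pms L ι₁ V Γ = pbObj (pLeafOf L ι₁ d t) := rfl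

/-- its degree-4 trace is the period functional `ℓ` of `P(L, ι₁)` -/
theorem toyUniverse₂_tr_pms (L : CMField) (ι₁ : L →+* ℂ) (V : HermSpace3 L ι₁) (Γ : Level V) :
    (toyUniverse₂ d t).tr ((toyUniverse₂ d t).pms L ι₁ V Γ) 4 = (pLeafOf L ι₁ d t).ℓ := by
  show trOf (pbObj (pLeafOf L ι₁ d t)) 4 = _
  exact trOf_pbObj _

/-- and is nonzero — the hypothesis of the Gysin leg for the blocks in play (DESIGN.md §7) -/
theorem toyUniverse₂_tr_pms_ne_zero (L : CMField) (ι₁ : L →+* ℂ) (V : HermSpace3 L ι₁) (Γ : Level V) :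
    (toyUniverse₂ d t).tr ((toyUniverse₂ d t).pms L ι₁ V Γ) 4 ≠ 0 := by
  rw [toyUniverse₂_tr_pms]
  exact pLeafOf_ℓ_ne_zero L ι₁ d t

/-- every block of the assignment has a nonzero period functional -/
theorem plOf_ℓ_ne_zero (L : CMField) (ι₁ : L →+* ℂ) : (plOf d t L ι₁).ℓ ≠ 0 :=
  pLeafOf_ℓ_ne_zero L ι₁ d t

end universe₂

end

end HodgeCM.ToyG2
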